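import Summits.HodgeConjecture.CorCM.IrreducibleOddWeightsIsotypicMultiplicityCMFields
import HarnessLib

/-!
# Isotypic cells, XIV: ONE COMPONENT AGAINST MANY — inside an absolutely irreducible class a LONE component `b`
# interacts with a partner assembled from components `b′_k` IFF `b` is a ℚ-combination of the `b′_k`; the class defect
# is then `dim A`, otherwise `0`

COR-CM (cell `pub-hodgecm2`, binder seat `b16` gen 70, count-neutral claim ISOTYPIC SPLITTING OF THE DEFECT, file I14 —
abstract `G`-set level, type ranks and CM fields; theorems only, no definition, no named fact, no `sorry`).  NEW as
stated, hence under `Summits/`.  HONEST FRAMING: the special case `|J₀| = 1` of file I9/I10's relation count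
`(rank b + rank b′ − rank(b ⊔ b′))·dim A`, made explicit because it is the shape met in practice (an (IRR) pivot on one
side, a pivot with multiplicities — e.g. a Galois pivot — on the other); linear algebra of odd weights with consequences
for `dim MT(A₀ × A₁)` (Kubota–Dodson rank = `dim MT`, Pohlmann); nothing about Hodge classes is asserted; `HC_CM` is
neither used nor asserted.

SETTING.  A reference stable irreducible `A ≤ ℚ^{Y}` with SCALAR COMMUTANT; ONE equivariant embedding
`ι : ℚ^{Y} → ℚ^{Y₀}` injective on `A` and the shadow `w₀ = ι(b)`, `b ∈ A`; on the other pivot jointly independent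
equivariant embeddings `ι′_k : ℚ^{Y} → ℚ^{Y₁}` and `w₁ = Σ_k ι′_k(b′_k)`, `b′_k ∈ A`.

* §1 rank bookkeeping: `rank(b ⊔ b′) = rank b′` if `b ∈ span{b′_k}`, `= rank b′ + 1` if not.
* §2 **THE LONE-COMPONENT DICHOTOMY** (`finrank_span_shadowCoeff_inf_eq_finrank_of_mem_span`,
  `span_shadowCoeff_inf_eq_bot_of_not_mem_span`): **`dim(S(w₀) ∩ S(w₁)) = dim A` if `0 ≠ b ∈ span_ℚ{b′_k}`, and
  `S(w₀) ∩ S(w₁) = 0` if `b ∉ span_ℚ{b′_k}`** — gen 69 Q3's dichotomy («`b′ ∥ b` or not») with multiplicities on the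
  partner's side: ABSORPTION `S(w₀) ≤ S(w₁)` happens exactly when the lone component is a rational combination of the
  partner's components read in the reference module.
* §3 type ranks (`typeRank_add_typeRank_eq_add_finrank_of_mem_span`, `typeRank_add_typeRank_eq_of_not_mem_span`) and
  §4 CM fields (`cmTypeRank_add_cmTypeRank_eq_add_finrank_of_mem_span`, `cmTypeRank_add_cmTypeRank_eq_of_not_mem_span`):
  **`dim Hg(A₀)+dim Hg(A₁)−dim Hg(A₀×A₁) = dim A` or `Hg(A₀×A₁) = Hg(A₀)×Hg(A₁)`** according as `b ∈ span_ℚ{b′_k}` or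
  not.

## References

* [Gordon1999HodgeAVSurvey] B. B. Gordon, *A survey of the Hodge conjecture for abelian varieties*, §3 Theorem (Imai,
  Murty) with proof, 7.5–7.7, 9.4.3.
* [Lang2002] S. Lang, *Algebra*, 3rd ed., XVII §3.
* [Serre1977] J.-P. Serre, *Linear Representations of Finite Groups*, GTM 42, §2.6.
-/

set_option autoImplicit false

noncomputable section

open scoped BigOperators Classical

universe u u₁ v v' v'' vY w

namespace Summit.HodgeConjecture.CorCM.IrrOdd

open Literature.NumberTheory.ComplexMultiplication

/-! ### §1 Rank bookkeeping for a lone vector against a tuple -/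

section Rank

variable {V : Type v} [AddCommGroup V] [Module ℚ V] [FiniteDimensional ℚ V]

omit [FiniteDimensional ℚ V] in
/-- `rank(b ⊔ b′) = rank(b′)` when `b ∈ span{b′_k}`. [folklore] -/
theorem finrank_span_range_sum_elim_const_eq_of_mem_span {J₁ : Type u₁} {b : V} {b₁ : J₁ → V}
    (hb : b ∈ Submodule.span ℚ (Set.range b₁)) :
    Module.finrank ℚ ↥(Submodule.span ℚ (Set.range (Sum.elim (fun _ : Unit => b) b₁))) =
      Module.finrank ℚ ↥(Submodule.span ℚ (Set.range b₁)) := by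
  rw [Set.Sum.elim_range, Set.range_const, Submodule.span_union,
    sup_eq_right.2 ((Submodule.span_singleton_le_iff_mem b _).2 hb)]

/-- `rank(b ⊔ b′) = rank(b′) + 1` when `b ∉ span{b′_k}`. [folklore] -/
theorem finrank_span_range_sum_elim_const_eq_of_not_mem_span {J₁ : Type u₁} {b : V} {b₁ : J₁ → V}
    (hb : b ∉ Submodule.span ℚ (Set.range b₁)) :
    Module.finrank ℚ ↥(Submodule.span ℚ (Set.range (Sum.elim (fun _ : Unit => b) b₁))) =
      Module.finrank ℚ ↥(Submodule.span ℚ (Set.range b₁)) + 1 := by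
  have hb0 : b ≠ 0 := fun h => hb (h ▸ Submodule.zero_mem _)
  rw [Set.Sum.elim_range, Set.range_const, Submodule.span_union]
  have hinf : Submodule.span ℚ {b} ⊓ Submodule.span ℚ (Set.range b₁) = ⊥ := by
    rw [eq_bot_iff]
    rintro x ⟨hx₁, hx₂⟩
    obtain ⟨c, rfl⟩ := Submodule.mem_span_singleton.1 hx₁
    by_cases hc : c = 0
    · rw [hc, zero_smul]
      exact Submodule.zero_mem _
    · exfalso
      apply hb
      have h := Submodule.smul_mem _ c⁻¹ hx₂
      rwa [smul_smul, inv_mul_cancel₀ hc, one_smul] at h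
  have h := Submodule.finrank_sup_add_finrank_inf_eq (Submodule.span ℚ {b}) (Submodule.span ℚ (Set.range b₁))
  rw [hinf, finrank_bot, add_zero, finrank_span_singleton hb0] at h
  omega

omit [FiniteDimensional ℚ V] in
/-- `rank(b) = 1` for a non-zero lone vector. [folklore] -/
theorem finrank_span_range_const_eq_one {b : V} (hb0 : b ≠ 0) :
    Module.finrank ℚ ↥(Submodule.span ℚ (Set.range fun _ : Unit => b)) = 1 := by
  rw [Set.range_const, finrank_span_singleton hb0]

end Rank

/-! ### §2 The lone-component dichotomy -/

variable {G : Type w} [Group G] {Y : Type vY} [MulAction G Y] [Fintype Y]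
  {Y₀ : Type v'} [MulAction G Y₀] [Fintype Y₀] {Y₁ : Type v''} [MulAction G Y₁] [Fintype Y₁]

/-- **ABSORPTION WITH MULTIPLICITIES: `dim(S(ι b) ∩ S(Σ_k ι′_k b′_k)) = dim A` when `0 ≠ b ∈ span_ℚ{b′_k}`** (`A`
stable irreducible with scalar commutant; `ι` equivariant and injective on `A`; `ι′_k` equivariant, jointly
independent on `A`). [cite: Lang2002, XVII §3] [cite: Serre1977, §2.6]
[cite: Gordon1999HodgeAVSurvey, §3 Theorem (proof)] -/
theorem finrank_span_shadowCoeff_inf_eq_finrank_of_mem_span {A : Submodule ℚ (Y → ℚ)}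
    (hAst : ∀ (k : G) (a : Y → ℚ), a ∈ A → (fun y => a (k • y)) ∈ A)
    (hAirr : ∀ W : Submodule ℚ (Y → ℚ), W ≤ A → W ≠ ⊥ →
      (∀ (k : G) (f : Y → ℚ), f ∈ W → (fun y => f (k • y)) ∈ W) → W = A)
    (hsc : ∀ L : (Y → ℚ) →ₗ[ℚ] (Y → ℚ), (∀ a ∈ A, L a ∈ A) →
      (∀ (k : G) (a : Y → ℚ), a ∈ A → L (fun y => a (k • y)) = fun y => L a (k • y)) → ∃ c : ℚ, ∀ a ∈ A, L a = c • a)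
    (ι₀ : (Y → ℚ) →ₗ[ℚ] (Y₀ → ℚ)) {J₁ : Type u₁} [Fintype J₁] (ι₁ : J₁ → ((Y → ℚ) →ₗ[ℚ] (Y₁ → ℚ)))
    (hι₀eq : ∀ (k : G) (a : Y → ℚ), a ∈ A → ι₀ (fun y => a (k • y)) = fun y => ι₀ a (k • y))
    (hι₁eq : ∀ (j : J₁) (k : G) (a : Y → ℚ), a ∈ A → ι₁ j (fun y => a (k • y)) = fun y => ι₁ j a (k • y))
    (hinj₀ : ∀ a ∈ A, ι₀ a = 0 → a = 0)
    (hind₁ : ∀ f : J₁ → (Y → ℚ), (∀ j, f j ∈ A) → ∑ j, ι₁ j (f j) = 0 → ∀ j, f j = 0)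
    {b : Y → ℚ} {b₁ : J₁ → (Y → ℚ)} (hb : b ∈ A) (hb₁ : ∀ j, b₁ j ∈ A) (hb0 : b ≠ 0)
    (hmem : b ∈ Submodule.span ℚ (Set.range b₁)) :
    Module.finrank ℚ ↥(Submodule.span ℚ (Set.range fun y : Y₀ => fun g : G => ι₀ b (g • y)) ⊓
        Submodule.span ℚ (Set.range fun y : Y₁ => fun g : G => (∑ j, ι₁ j (b₁ j)) (g • y))) =
      Module.finrank ℚ A := by
  have hcls := finrank_span_shadowCoeff_inf_add_rank_mul_eq hAst hAirr hsc (fun _ : Unit => ι₀) ι₁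
    (fun _ k a ha => hι₀eq k a ha) hι₁eq
    (fun f hf h0 j => hinj₀ _ (hf j) (by rw [Fintype.sum_unique] at h0; exact h0)) hind₁ (b₀ := fun _ => b)
    (fun _ => hb) hb₁
  rw [Fintype.sum_unique, finrank_span_range_sum_elim_const_eq_of_mem_span hmem,
    finrank_span_range_const_eq_one hb0, add_mul, one_mul] at hcls
  have e : (fun (y : Y₀) (g : G) => (fun _ : Unit => ι₀) default ((fun _ : Unit => b) default)
      (g • y)) = fun (y : Y₀) (g : G) => ι₀ b (g • y) := rfl
  rw [e] at hcls
  omega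

/-- **NO ABSORPTION: `S(ι b) ∩ S(Σ_k ι′_k b′_k) = 0` when `b ∉ span_ℚ{b′_k}`.** [cite: Lang2002, XVII §3]
[cite: Serre1977, §2.6] [cite: Gordon1999HodgeAVSurvey, §3 Theorem (proof)] -/
theorem span_shadowCoeff_inf_eq_bot_of_not_mem_span {A : Submodule ℚ (Y → ℚ)}
    (hAst : ∀ (k : G) (a : Y → ℚ), a ∈ A → (fun y => a (k • y)) ∈ A)
    (hAirr : ∀ W : Submodule ℚ (Y → ℚ), W ≤ A → W ≠ ⊥ →
      (∀ (k : G) (f : Y → ℚ), f ∈ W → (fun y => f (k • y)) ∈ W) → W = A)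
    (hsc : ∀ L : (Y → ℚ) →ₗ[ℚ] (Y → ℚ), (∀ a ∈ A, L a ∈ A) →
      (∀ (k : G) (a : Y → ℚ), a ∈ A → L (fun y => a (k • y)) = fun y => L a (k • y)) → ∃ c : ℚ, ∀ a ∈ A, L a = c • a)
    (ι₀ : (Y → ℚ) →ₗ[ℚ] (Y₀ → ℚ)) {J₁ : Type u₁} [Fintype J₁] (ι₁ : J₁ → ((Y → ℚ) →ₗ[ℚ] (Y₁ → ℚ)))
    (hι₀eq : ∀ (k : G) (a : Y → ℚ), a ∈ A → ι₀ (fun y => a (k • y)) = fun y => ι₀ a (k • y))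
    (hι₁eq : ∀ (j : J₁) (k : G) (a : Y → ℚ), a ∈ A → ι₁ j (fun y => a (k • y)) = fun y => ι₁ j a (k • y))
    (hinj₀ : ∀ a ∈ A, ι₀ a = 0 → a = 0)
    (hind₁ : ∀ f : J₁ → (Y → ℚ), (∀ j, f j ∈ A) → ∑ j, ι₁ j (f j) = 0 → ∀ j, f j = 0)
    {b : Y → ℚ} {b₁ : J₁ → (Y → ℚ)} (hb : b ∈ A) (hb₁ : ∀ j, b₁ j ∈ A)
    (hnmem : b ∉ Submodule.span ℚ (Set.range b₁)) :
    Submodule.span ℚ (Set.range fun y : Y₀ => fun g : G => ι₀ b (g • y)) ⊓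
        Submodule.span ℚ (Set.range fun y : Y₁ => fun g : G => (∑ j, ι₁ j (b₁ j)) (g • y)) = ⊥ := by
  have hb0 : b ≠ 0 := fun h => hnmem (h ▸ Submodule.zero_mem _)
  have hcls := finrank_span_shadowCoeff_inf_add_rank_mul_eq hAst hAirr hsc (fun _ : Unit => ι₀) ι₁
    (fun _ k a ha => hι₀eq k a ha) hι₁eq
    (fun f hf h0 j => hinj₀ _ (hf j) (by rw [Fintype.sum_unique] at h0; exact h0)) hind₁ (b₀ := fun _ => b)
    (fun _ => hb) hb₁
  rw [Fintype.sum_unique, finrank_span_range_sum_elim_const_eq_of_not_mem_span hnmem,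
    finrank_span_range_const_eq_one hb0, add_mul, one_mul, add_mul, one_mul] at hcls
  have e : (fun (y : Y₀) (g : G) => (fun _ : Unit => ι₀) default ((fun _ : Unit => b) default)
      (g • y)) = fun (y : Y₀) (g : G) => ι₀ b (g • y) := rfl
  rw [e] at hcls
  haveI : FiniteDimensional ℚ ↥(Submodule.span ℚ (Set.range fun y : Y₀ => fun g : G => ι₀ b (g • y))) :=
    FiniteDimensional.span_of_finite ℚ (Set.finite_range _)
  haveI : FiniteDimensional ℚ ↥(Submodule.span ℚ (Set.range fun y : Y₀ => fun g : G => ι₀ b (g • y)) ⊓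
      Submodule.span ℚ (Set.range fun y : Y₁ => fun g : G => (∑ j, ι₁ j (b₁ j)) (g • y))) :=
    Submodule.finiteDimensional_of_le inf_le_left
  rw [← Submodule.finrank_eq_zero]
  omega

/-! ### §3 Type ranks -/

section TypeRanks

variable {I : Type u} {E : I → Type v} [∀ i, MulAction G (E i)] [∀ i, Fintype (E i)] [Fintype I] [∀ i, Nonempty (E i)]

/-- **LONE COMPONENT, ABSORBED (type ranks)**: `w₀ = ι(b)`, `w₁ = Σ_k ι′_k(b′_k)` as above over pivots refining the
trace classes, `0 ≠ b ∈ span_ℚ{b′_k}` ⟹ `rank Φ₀ + rank Φ₁ = rank(Φ₀,Φ₁) + 1 + dim A`.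
[cite: Gordon1999HodgeAVSurvey, §3 Theorem, 7.5–7.7 and 9.4.3] [cite: Lang2002, XVII §3] -/
theorem typeRank_add_typeRank_eq_add_finrank_of_mem_span {ρ : G} {Φ : ∀ i, Set (E i)}
    (h : ∀ i, IsCMTypeWith ρ (Φ i)) {i₀ i₁ : I} (hI : ∀ j, j = i₀ ∨ j = i₁) (h01 : i₀ ≠ i₁)
    (r₀ : E i₀ → Y₀) (r₁ : E i₁ → Y₁) (hr₀ : ∀ (g : G) (x : E i₀), r₀ (g • x) = g • r₀ x)
    (hr₁ : ∀ (g : G) (x : E i₁), r₁ (g • x) = g • r₁ x)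
    (hfine₀ : ∀ x x' : E i₀, r₀ x = r₀ x' → ∃ n : G, (∀ y : E i₁, n • y = y) ∧ n • x = x')
    (hfine₁ : ∀ x x' : E i₁, r₁ x = r₁ x' → ∃ n : G, (∀ y : E i₀, n • y = y) ∧ n • x = x')
    {A : Submodule ℚ (Y → ℚ)}
    (hAst : ∀ (k : G) (a : Y → ℚ), a ∈ A → (fun y => a (k • y)) ∈ A)
    (hAirr : ∀ W : Submodule ℚ (Y → ℚ), W ≤ A → W ≠ ⊥ →
      (∀ (k : G) (f : Y → ℚ), f ∈ W → (fun y => f (k • y)) ∈ W) → W = A)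
    (hsc : ∀ L : (Y → ℚ) →ₗ[ℚ] (Y → ℚ), (∀ a ∈ A, L a ∈ A) →
      (∀ (k : G) (a : Y → ℚ), a ∈ A → L (fun y => a (k • y)) = fun y => L a (k • y)) → ∃ c : ℚ, ∀ a ∈ A, L a = c • a)
    (ι₀ : (Y → ℚ) →ₗ[ℚ] (Y₀ → ℚ)) {J₁ : Type u₁} [Fintype J₁] (ι₁ : J₁ → ((Y → ℚ) →ₗ[ℚ] (Y₁ → ℚ)))
    (hι₀eq : ∀ (k : G) (a : Y → ℚ), a ∈ A → ι₀ (fun y => a (k • y)) = fun y => ι₀ a (k • y))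
    (hι₁eq : ∀ (j : J₁) (k : G) (a : Y → ℚ), a ∈ A → ι₁ j (fun y => a (k • y)) = fun y => ι₁ j a (k • y))
    (hinj₀ : ∀ a ∈ A, ι₀ a = 0 → a = 0)
    (hind₁ : ∀ f : J₁ → (Y → ℚ), (∀ j, f j ∈ A) → ∑ j, ι₁ j (f j) = 0 → ∀ j, f j = 0)
    {b : Y → ℚ} {b₁ : J₁ → (Y → ℚ)} (hb : b ∈ A) (hb₁ : ∀ j, b₁ j ∈ A) (hb0 : b ≠ 0)
    (hmem : b ∈ Submodule.span ℚ (Set.range b₁))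
    (hw₀ : (fun y : Y₀ => ∑ x ∈ Finset.univ.filter (fun x => r₀ x = y), antiVec (Φ i₀) (1 : G) x) = ι₀ b)
    (hw₁ : (fun y : Y₁ => ∑ x ∈ Finset.univ.filter (fun x => r₁ x = y), antiVec (Φ i₁) (1 : G) x) =
      ∑ j, ι₁ j (b₁ j)) :
    typeRank G (Φ i₀) + typeRank G (Φ i₁) = typeRank G (sigmaType Φ) + 1 + Module.finrank ℚ A := by
  have hcls := typeRank_add_typeRank_add_rank_mul_eq_of_class h hI h01 r₀ r₁ hr₀ hr₁ hfine₀ hfine₁ hAst hAirr hsc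
    (fun _ : Unit => ι₀) ι₁ (fun _ k a ha => hι₀eq k a ha) hι₁eq
    (fun f hf h0 j => hinj₀ _ (hf j) (by rw [Fintype.sum_unique] at h0; exact h0)) hind₁ (b₀ := fun _ => b)
    (fun _ => hb) hb₁ (by rw [Fintype.sum_unique]; exact hw₀) hw₁
  rw [finrank_span_range_sum_elim_const_eq_of_mem_span hmem, finrank_span_range_const_eq_one hb0, add_mul,
    one_mul] at hcls
  omega

/-- **LONE COMPONENT, NOT ABSORBED (type ranks)**: `b ∉ span_ℚ{b′_k}` ⟹ ADDITIVITY
`rank Φ₀ + rank Φ₁ = rank(Φ₀,Φ₁) + 1`. [cite: Gordon1999HodgeAVSurvey, §3 Theorem, 7.5–7.7 and 9.4.3]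
[cite: Lang2002, XVII §3] -/
theorem typeRank_add_typeRank_eq_of_not_mem_span {ρ : G} {Φ : ∀ i, Set (E i)}
    (h : ∀ i, IsCMTypeWith ρ (Φ i)) {i₀ i₁ : I} (hI : ∀ j, j = i₀ ∨ j = i₁) (h01 : i₀ ≠ i₁)
    (r₀ : E i₀ → Y₀) (r₁ : E i₁ → Y₁) (hr₀ : ∀ (g : G) (x : E i₀), r₀ (g • x) = g • r₀ x)
    (hr₁ : ∀ (g : G) (x : E i₁), r₁ (g • x) = g • r₁ x)
    (hfine₀ : ∀ x x' : E i₀, r₀ x = r₀ x' → ∃ n : G, (∀ y : E i₁, n • y = y) ∧ n • x = x')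
    (hfine₁ : ∀ x x' : E i₁, r₁ x = r₁ x' → ∃ n : G, (∀ y : E i₀, n • y = y) ∧ n • x = x')
    {A : Submodule ℚ (Y → ℚ)}
    (hAst : ∀ (k : G) (a : Y → ℚ), a ∈ A → (fun y => a (k • y)) ∈ A)
    (hAirr : ∀ W : Submodule ℚ (Y → ℚ), W ≤ A → W ≠ ⊥ →
      (∀ (k : G) (f : Y → ℚ), f ∈ W → (fun y => f (k • y)) ∈ W) → W = A)
    (hsc : ∀ L : (Y → ℚ) →ₗ[ℚ] (Y → ℚ), (∀ a ∈ A, L a ∈ A) →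
      (∀ (k : G) (a : Y → ℚ), a ∈ A → L (fun y => a (k • y)) = fun y => L a (k • y)) → ∃ c : ℚ, ∀ a ∈ A, L a = c • a)
    (ι₀ : (Y → ℚ) →ₗ[ℚ] (Y₀ → ℚ)) {J₁ : Type u₁} [Fintype J₁] (ι₁ : J₁ → ((Y → ℚ) →ₗ[ℚ] (Y₁ → ℚ)))
    (hι₀eq : ∀ (k : G) (a : Y → ℚ), a ∈ A → ι₀ (fun y => a (k • y)) = fun y => ι₀ a (k • y))
    (hι₁eq : ∀ (j : J₁) (k : G) (a : Y → ℚ), a ∈ A → ι₁ j (fun y => a (k • y)) = fun y => ι₁ j a (k • y))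
    (hinj₀ : ∀ a ∈ A, ι₀ a = 0 → a = 0)
    (hind₁ : ∀ f : J₁ → (Y → ℚ), (∀ j, f j ∈ A) → ∑ j, ι₁ j (f j) = 0 → ∀ j, f j = 0)
    {b : Y → ℚ} {b₁ : J₁ → (Y → ℚ)} (hb : b ∈ A) (hb₁ : ∀ j, b₁ j ∈ A)
    (hnmem : b ∉ Submodule.span ℚ (Set.range b₁))
    (hw₀ : (fun y : Y₀ => ∑ x ∈ Finset.univ.filter (fun x => r₀ x = y), antiVec (Φ i₀) (1 : G) x) = ι₀ b)
    (hw₁ : (fun y : Y₁ => ∑ x ∈ Finset.univ.filter (fun x => r₁ x = y), antiVec (Φ i₁) (1 : G) x) =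
      ∑ j, ι₁ j (b₁ j)) :
    typeRank G (Φ i₀) + typeRank G (Φ i₁) = typeRank G (sigmaType Φ) + 1 := by
  have hb0 : b ≠ 0 := fun h => hnmem (h ▸ Submodule.zero_mem _)
  have hcls := typeRank_add_typeRank_add_rank_mul_eq_of_class h hI h01 r₀ r₁ hr₀ hr₁ hfine₀ hfine₁ hAst hAirr hsc
    (fun _ : Unit => ι₀) ι₁ (fun _ k a ha => hι₀eq k a ha) hι₁eq
    (fun f hf h0 j => hinj₀ _ (hf j) (by rw [Fintype.sum_unique] at h0; exact h0)) hind₁ (b₀ := fun _ => b)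
    (fun _ => hb) hb₁ (by rw [Fintype.sum_unique]; exact hw₀) hw₁
  rw [finrank_span_range_sum_elim_const_eq_of_not_mem_span hnmem, finrank_span_range_const_eq_one hb0, add_mul,
    one_mul, add_mul, one_mul] at hcls
  omega

end TypeRanks

end Summit.HodgeConjecture.CorCM.IrrOdd

/-! ### §4 CM fields -/

namespace Summit.HodgeConjecture.CorCM

open CategoryTheory CategoryTheory.Limits NumberField Module IntermediateField
open Literature.NumberTheory.ComplexMultiplication
open Literature.AlgebraicGeometry.Motives (AbelianVariety CMType)
open Literature.AlgebraicGeometry.Motives.AbelianVariety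
open Literature.AlgebraicGeometry.HodgeTheory
open Literature.AlgebraicGeometry.ComplexMultiplication (IsCMTypeRealisation)
open Literature.AlgebraicGeometry.Pohlmann1968

variable {I : Type} [Fintype I] {K : I → Type} [∀ i, Field (K i)] [∀ i, NumberField (K i)] [∀ i, IsCMField (K i)]
  {T₀ : Type} [Field T₀] [NumberField T₀] {T₁ : Type} [Field T₁] [NumberField T₁]
  {Y : Type vY} [MulAction (ℂ ≃+* ℂ) Y] [Fintype Y]

/-- **LONE COMPONENT, ABSORBED (CM fields)**: `T₀ ⊆ K_{i₀}`, `T₁ ⊆ K_{i₁}` subfields containing the traces (TR); the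
shadow `w₀ = ι(b)` a single embedded copy of a reference `Aut(ℂ)`-stable irreducible `A` with scalar commutant, the
partner's shadow `w₁ = Σ_k ι′_k(b′_k)` assembled from jointly independent embedded copies of the same `A`; if
`0 ≠ b ∈ span_ℚ{b′_k}` then **`cmTypeRank Φ₀ + cmTypeRank Φ₁ = cmFamilyRank Φ + 1 + dim A`**: the defect
`dim Hg(A₀)+dim Hg(A₁)−dim Hg(A₀×A₁)` is `dim A`. [cite: Gordon1999HodgeAVSurvey, §3 Theorem, 7.5–7.7 and 9.4.3]
[cite: Lang2002, XVII §3] [cite: Serre1977, §2.6] -/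
theorem cmTypeRank_add_cmTypeRank_eq_add_finrank_of_mem_span {i₀ i₁ : I} (h01 : i₀ ≠ i₁) (hI : ∀ l, l = i₀ ∨ l = i₁)
    (Φ : ∀ i, CMType (K i)) [Algebra T₀ (K i₀)] [Algebra T₁ (K i₁)]
    (htr₀ : ∀ (a : K i₀ →+* ℂ) (k : K i₀), a k ∈ normalClosure ℚ (K i₁) ℂ → k ∈ Set.range (algebraMap T₀ (K i₀)))
    (htr₁ : ∀ (b : K i₁ →+* ℂ) (k : K i₁), b k ∈ normalClosure ℚ (K i₀) ℂ → k ∈ Set.range (algebraMap T₁ (K i₁)))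
    {A : Submodule ℚ (Y → ℚ)}
    (hAst : ∀ (k : ℂ ≃+* ℂ) (a : Y → ℚ), a ∈ A → (fun y => a (k • y)) ∈ A)
    (hAirr : ∀ W : Submodule ℚ (Y → ℚ), W ≤ A → W ≠ ⊥ →
      (∀ (k : ℂ ≃+* ℂ) (f : Y → ℚ), f ∈ W → (fun y => f (k • y)) ∈ W) → W = A)
    (hsc : ∀ L : (Y → ℚ) →ₗ[ℚ] (Y → ℚ), (∀ a ∈ A, L a ∈ A) →
      (∀ (k : ℂ ≃+* ℂ) (a : Y → ℚ), a ∈ A → L (fun y => a (k • y)) = fun y => L a (k • y)) →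
        ∃ c : ℚ, ∀ a ∈ A, L a = c • a)
    (ι₀ : (Y → ℚ) →ₗ[ℚ] ((T₀ →+* ℂ) → ℚ)) {J₁ : Type} [Fintype J₁] (ι₁ : J₁ → ((Y → ℚ) →ₗ[ℚ] ((T₁ →+* ℂ) → ℚ)))
    (hι₀eq : ∀ (k : ℂ ≃+* ℂ) (a : Y → ℚ), a ∈ A → ι₀ (fun y => a (k • y)) = fun y => ι₀ a (k • y))
    (hι₁eq : ∀ (j : J₁) (k : ℂ ≃+* ℂ) (a : Y → ℚ), a ∈ A → ι₁ j (fun y => a (k • y)) = fun y => ι₁ j a (k • y))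
    (hinj₀ : ∀ a ∈ A, ι₀ a = 0 → a = 0)
    (hind₁ : ∀ f : J₁ → (Y → ℚ), (∀ j, f j ∈ A) → ∑ j, ι₁ j (f j) = 0 → ∀ j, f j = 0)
    {b : Y → ℚ} {b₁ : J₁ → (Y → ℚ)} (hb : b ∈ A) (hb₁ : ∀ j, b₁ j ∈ A) (hb0 : b ≠ 0)
    (hmem : b ∈ Submodule.span ℚ (Set.range b₁))
    (hw₀ : (fun y : T₀ →+* ℂ => ∑ t ∈ Finset.univ.filter (fun t : K i₀ →+* ℂ => t.comp (algebraMap T₀ (K i₀)) = y),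
        antiVec (Φ i₀).1 (1 : ℂ ≃+* ℂ) t) = ι₀ b)
    (hw₁ : (fun y : T₁ →+* ℂ => ∑ t ∈ Finset.univ.filter (fun t : K i₁ →+* ℂ => t.comp (algebraMap T₁ (K i₁)) = y),
        antiVec (Φ i₁).1 (1 : ℂ ≃+* ℂ) t) = ∑ j, ι₁ j (b₁ j)) :
    cmTypeRank (Φ i₀) + cmTypeRank (Φ i₁) = CMAlgebra.cmFamilyRank Φ + 1 + Module.finrank ℚ A := by
  haveI : ∀ i, Nonempty (K i →+* ℂ) := fun i => inferInstance
  exact IrrOdd.typeRank_add_typeRank_eq_add_finrank_of_mem_span (G := ℂ ≃+* ℂ) (E := fun i => K i →+* ℂ)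
    (Φ := fun i => (Φ i).1) (fun i => isCMTypeWith_conj (Φ i)) hI h01
    (fun t : K i₀ →+* ℂ => t.comp (algebraMap T₀ (K i₀))) (fun t : K i₁ →+* ℂ => t.comp (algebraMap T₁ (K i₁)))
    (fun _ _ => rfl) (fun _ _ => rfl) (exists_stab_smul_eq_of_comp_eq_of_trace_le i₁ htr₀)
    (exists_stab_smul_eq_of_comp_eq_of_trace_le i₀ htr₁) hAst hAirr hsc ι₀ ι₁ hι₀eq hι₁eq hinj₀ hind₁ hb hb₁ hb0 hmem
    hw₀ hw₁

/-- **LONE COMPONENT, NOT ABSORBED (CM fields)**: in the same setting, `b ∉ span_ℚ{b′_k}` ⟹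
**`cmTypeRank Φ₀ + cmTypeRank Φ₁ = cmFamilyRank Φ + 1`**, i.e. `Hg(A₀ × A₁) = Hg(A₀) × Hg(A₁)`.
[cite: Gordon1999HodgeAVSurvey, §3 Theorem, 7.5–7.7 and 9.4.3] [cite: Lang2002, XVII §3] [cite: Serre1977, §2.6] -/
theorem cmTypeRank_add_cmTypeRank_eq_of_not_mem_span {i₀ i₁ : I} (h01 : i₀ ≠ i₁) (hI : ∀ l, l = i₀ ∨ l = i₁)
    (Φ : ∀ i, CMType (K i)) [Algebra T₀ (K i₀)] [Algebra T₁ (K i₁)]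
    (htr₀ : ∀ (a : K i₀ →+* ℂ) (k : K i₀), a k ∈ normalClosure ℚ (K i₁) ℂ → k ∈ Set.range (algebraMap T₀ (K i₀)))
    (htr₁ : ∀ (b : K i₁ →+* ℂ) (k : K i₁), b k ∈ normalClosure ℚ (K i₀) ℂ → k ∈ Set.range (algebraMap T₁ (K i₁)))
    {A : Submodule ℚ (Y → ℚ)}
    (hAst : ∀ (k : ℂ ≃+* ℂ) (a : Y → ℚ), a ∈ A → (fun y => a (k • y)) ∈ A)
    (hAirr : ∀ W : Submodule ℚ (Y → ℚ), W ≤ A → W ≠ ⊥ →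
      (∀ (k : ℂ ≃+* ℂ) (f : Y → ℚ), f ∈ W → (fun y => f (k • y)) ∈ W) → W = A)
    (hsc : ∀ L : (Y → ℚ) →ₗ[ℚ] (Y → ℚ), (∀ a ∈ A, L a ∈ A) →
      (∀ (k : ℂ ≃+* ℂ) (a : Y → ℚ), a ∈ A → L (fun y => a (k • y)) = fun y => L a (k • y)) →
        ∃ c : ℚ, ∀ a ∈ A, L a = c • a)
    (ι₀ : (Y → ℚ) →ₗ[ℚ] ((T₀ →+* ℂ) → ℚ)) {J₁ : Type} [Fintype J₁] (ι₁ : J₁ → ((Y → ℚ) →ₗ[ℚ] ((T₁ →+* ℂ) → ℚ)))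
    (hι₀eq : ∀ (k : ℂ ≃+* ℂ) (a : Y → ℚ), a ∈ A → ι₀ (fun y => a (k • y)) = fun y => ι₀ a (k • y))
    (hι₁eq : ∀ (j : J₁) (k : ℂ ≃+* ℂ) (a : Y → ℚ), a ∈ A → ι₁ j (fun y => a (k • y)) = fun y => ι₁ j a (k • y))
    (hinj₀ : ∀ a ∈ A, ι₀ a = 0 → a = 0)
    (hind₁ : ∀ f : J₁ → (Y → ℚ), (∀ j, f j ∈ A) → ∑ j, ι₁ j (f j) = 0 → ∀ j, f j = 0)
    {b : Y → ℚ} {b₁ : J₁ → (Y → ℚ)} (hb : b ∈ A) (hb₁ : ∀ j, b₁ j ∈ A)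
    (hnmem : b ∉ Submodule.span ℚ (Set.range b₁))
    (hw₀ : (fun y : T₀ →+* ℂ => ∑ t ∈ Finset.univ.filter (fun t : K i₀ →+* ℂ => t.comp (algebraMap T₀ (K i₀)) = y),
        antiVec (Φ i₀).1 (1 : ℂ ≃+* ℂ) t) = ι₀ b)
    (hw₁ : (fun y : T₁ →+* ℂ => ∑ t ∈ Finset.univ.filter (fun t : K i₁ →+* ℂ => t.comp (algebraMap T₁ (K i₁)) = y),
        antiVec (Φ i₁).1 (1 : ℂ ≃+* ℂ) t) = ∑ j, ι₁ j (b₁ j)) :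
    cmTypeRank (Φ i₀) + cmTypeRank (Φ i₁) = CMAlgebra.cmFamilyRank Φ + 1 := by
  haveI : ∀ i, Nonempty (K i →+* ℂ) := fun i => inferInstance
  exact IrrOdd.typeRank_add_typeRank_eq_of_not_mem_span (G := ℂ ≃+* ℂ) (E := fun i => K i →+* ℂ)
    (Φ := fun i => (Φ i).1) (fun i => isCMTypeWith_conj (Φ i)) hI h01
    (fun t : K i₀ →+* ℂ => t.comp (algebraMap T₀ (K i₀))) (fun t : K i₁ →+* ℂ => t.comp (algebraMap T₁ (K i₁)))
    (fun _ _ => rfl) (fun _ _ => rfl) (exists_stab_smul_eq_of_comp_eq_of_trace_le i₁ htr₀)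
    (exists_stab_smul_eq_of_comp_eq_of_trace_le i₀ htr₁) hAst hAirr hsc ι₀ ι₁ hι₀eq hι₁eq hinj₀ hind₁ hb hb₁ hnmem
    hw₀ hw₁

end Summit.HodgeConjecture.CorCM

end
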